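import Summits.Ventures.HodgeRepro2.T5SU11SphericalODE

/-!
# Monotonicity of the spherical functions of `SU(1,1)` in the Cartan parameter:
`t ↦ φ_λ(a_t)` is strictly decreasing on `[0, ∞)` for `0 < λ < 2` and strictly increasing for
`λ ∉ [0, 2]`; `φ_λ(g) < φ_λ(h) ⟺ |a(h)| < |a(g)|`

The radial equation of `T5SU11SphericalODE` in its `sinh`-form says that `w(t) = sinh 2t · u'(t)`
(`u(t) = sph λ (a_t)`, `u'` the derivative integral of `T5SU11SphericalDeriv`) has derivative
`λ(λ − 2) sinh 2t · u(t)` (`hasDerivAt_sinh_mul_deriv`). Since `u > 0` (`sph_hyp_pos`) and `sinh 2t > 0`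
for `t > 0`, `w` is strictly decreasing on `[0, ∞)` when `λ(λ − 2) < 0`, i.e. `0 < λ < 2`
(`strictAntiOn_sinh_mul_deriv`), and `w(0) = 0`, so **`u'(t) < 0` for `t > 0`** (`deriv_sph_hyp_neg`) and
**`u` is strictly decreasing on `[0, ∞)`** (`strictAntiOn_sph_hyp`); for `λ < 0` or `λ > 2` the signs
flip (`strictMonoOn_sinh_mul_deriv`, `deriv_sph_hyp_pos`, `strictMonoOn_sph_hyp`). On the group, with
`sph λ g = u(cartanT g)` and `cosh (cartanT g) = |a(g)|`: **`sph λ g < sph λ h ⟺ cartanT h < cartanT g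
⟺ |a(h)| < |a(g)|`** for `0 < λ < 2` (`sph_lt_sph_iff_cartanT`, `sph_lt_sph_iff_norm_mat`), and the
reverse for `λ ∉ [0, 2]` (`sph_lt_sph_iff_cartanT'`). In particular Harish-Chandra's `Ξ = φ₁` is a
strictly decreasing function of the Cartan parameter (`strictAntiOn_sph_one_hyp`). Nothing is claimed
about (N).

Blind lane: Mathlib + the HodgeRepro2 prefix only; no sorry; axioms ⊆ {propext, Classical.choice,
Quot.sound}.
-/

namespace Summit.Ventures.HodgeRepro2.T5SU11SphericalMonotone

open MeasureTheory Metric Set Filter Topology Complex intervalIntegral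
open T5SU11Unimodular T5SU11Fibration T5SU11Cartan T5SU11OneParameter T5SU11CartanProjection
  T5HaarCircle T5BergmanCoefficient T5SU11SphericalFunction T5SU11SphericalTwo
  T5SU11SphericalSymmetry T5SU11SphericalBounds T5SU11SphericalContinuous
  T5SU11SphericalAsymptotic T5SU11SphericalLp T5SU11SphericalCfun T5SU11SphericalLpSharp
  T5SU11SphericalXiLog T5SU11SphericalCfunLimit T5SU11SphericalStrict T5SU11SphericalDeriv
  T5SU11SphericalODE
open scoped Real

/-- `w(0) = 0`. -/
lemma sinh_mul_deriv_zero (lam : ℝ) :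
    Real.sinh (2 * 0) * ((2 * π)⁻¹ * ∫ φ in (-π)..π,
      (2 * Real.sinh (2 * 0) - 2 * Real.cosh (2 * 0) * Real.cos φ) * (-lam / 2) *
        (Real.cosh (2 * 0) - Real.sinh (2 * 0) * Real.cos φ) ^ (-lam / 2 - 1)) = 0 := by
  rw [mul_zero, Real.sinh_zero, zero_mul]

/-- `cartanT h < cartanT g ⟺ |a(h)| < |a(g)|` (`cosh` is strictly increasing on `[0, ∞)`). -/
lemma cartanT_lt_iff_norm_mat (g h : SU11) : cartanT h < cartanT g ↔ ‖mat h 0 0‖ < ‖mat g 0 0‖ := by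
  rw [← cosh_cartanT, ← cosh_cartanT, Real.cosh_lt_cosh, abs_of_nonneg (cartanT_nonneg h),
    abs_of_nonneg (cartanT_nonneg g)]

section measure

variable [MeasurableSpace Circle] [BorelSpace Circle]

/-- **The derivative of `w(t) = sinh 2t · u'(t)`** is `λ(λ − 2) sinh 2t · u(t)` (the radial ODE in
`sinh`-form). -/
theorem hasDerivAt_sinh_mul_deriv (lam t : ℝ) :
    HasDerivAt (fun t => Real.sinh (2 * t) * ((2 * π)⁻¹ * ∫ φ in (-π)..π,
        (2 * Real.sinh (2 * t) - 2 * Real.cosh (2 * t) * Real.cos φ) * (-lam / 2) *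
          (Real.cosh (2 * t) - Real.sinh (2 * t) * Real.cos φ) ^ (-lam / 2 - 1)))
      (lam * (lam - 2) * Real.sinh (2 * t) * sph lam (hyp t)) t := by
  have h2 : HasDerivAt (fun t : ℝ => 2 * t) 2 t := by
    simpa using (hasDerivAt_id' (x := t)).const_mul (2 : ℝ)
  have hw := h2.sinh.mul ((hasDerivAt_integral_laplace_deriv (-lam / 2) t).const_mul (2 * π)⁻¹)
  refine hw.congr_deriv ?_
  have := sph_hyp_ode lam t
  linear_combination this

/-- `w` is continuous. -/
lemma continuous_sinh_mul_deriv (lam : ℝ) :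
    Continuous fun t => Real.sinh (2 * t) * ((2 * π)⁻¹ * ∫ φ in (-π)..π,
      (2 * Real.sinh (2 * t) - 2 * Real.cosh (2 * t) * Real.cos φ) * (-lam / 2) *
        (Real.cosh (2 * t) - Real.sinh (2 * t) * Real.cos φ) ^ (-lam / 2 - 1)) :=
  continuous_iff_continuousAt.mpr fun t => (hasDerivAt_sinh_mul_deriv lam t).continuousAt

/-- **`w` is strictly decreasing on `[0, ∞)` for `0 < λ < 2`.** -/
theorem strictAntiOn_sinh_mul_deriv {lam : ℝ} (h0 : 0 < lam) (h2 : lam < 2) :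
    StrictAntiOn (fun t => Real.sinh (2 * t) * ((2 * π)⁻¹ * ∫ φ in (-π)..π,
      (2 * Real.sinh (2 * t) - 2 * Real.cosh (2 * t) * Real.cos φ) * (-lam / 2) *
        (Real.cosh (2 * t) - Real.sinh (2 * t) * Real.cos φ) ^ (-lam / 2 - 1))) (Ici 0) := by
  refine strictAntiOn_of_deriv_neg (convex_Ici 0) (continuous_sinh_mul_deriv lam).continuousOn
    fun t ht => ?_
  rw [interior_Ici] at ht
  rw [(hasDerivAt_sinh_mul_deriv lam t).deriv]
  have hs : 0 < Real.sinh (2 * t) := Real.sinh_pos_iff.mpr (by linarith [mem_Ioi.mp ht])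
  have hu : 0 < sph lam (hyp t) := sph_hyp_pos lam t
  have hl : lam * (lam - 2) < 0 := mul_neg_of_pos_of_neg h0 (by linarith)
  exact mul_neg_of_neg_of_pos (mul_neg_of_neg_of_pos hl hs) hu

/-- **`w` is strictly increasing on `[0, ∞)` for `λ < 0` or `λ > 2`.** -/
theorem strictMonoOn_sinh_mul_deriv {lam : ℝ} (h : lam < 0 ∨ 2 < lam) :
    StrictMonoOn (fun t => Real.sinh (2 * t) * ((2 * π)⁻¹ * ∫ φ in (-π)..π,
      (2 * Real.sinh (2 * t) - 2 * Real.cosh (2 * t) * Real.cos φ) * (-lam / 2) *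
        (Real.cosh (2 * t) - Real.sinh (2 * t) * Real.cos φ) ^ (-lam / 2 - 1))) (Ici 0) := by
  refine strictMonoOn_of_deriv_pos (convex_Ici 0) (continuous_sinh_mul_deriv lam).continuousOn
    fun t ht => ?_
  rw [interior_Ici] at ht
  rw [(hasDerivAt_sinh_mul_deriv lam t).deriv]
  have hs : 0 < Real.sinh (2 * t) := Real.sinh_pos_iff.mpr (by linarith [mem_Ioi.mp ht])
  have hu : 0 < sph lam (hyp t) := sph_hyp_pos lam t
  have hl : 0 < lam * (lam - 2) := by
    rcases h with h | h
    · exact mul_pos_of_neg_of_neg h (by linarith)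
    · exact mul_pos (by linarith) (by linarith)
  exact mul_pos (mul_pos hl hs) hu

/-- **`∂_t sph λ (a_t) < 0` for `t > 0` and `0 < λ < 2`.** -/
theorem deriv_sph_hyp_neg {lam : ℝ} (h0 : 0 < lam) (h2 : lam < 2) {t : ℝ} (ht : 0 < t) :
    deriv (fun t => sph lam (hyp t)) t < 0 := by
  have hw : Real.sinh (2 * t) * ((2 * π)⁻¹ * ∫ φ in (-π)..π,
      (2 * Real.sinh (2 * t) - 2 * Real.cosh (2 * t) * Real.cos φ) * (-lam / 2) *
        (Real.cosh (2 * t) - Real.sinh (2 * t) * Real.cos φ) ^ (-lam / 2 - 1)) <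
      Real.sinh (2 * 0) * ((2 * π)⁻¹ * ∫ φ in (-π)..π,
      (2 * Real.sinh (2 * 0) - 2 * Real.cosh (2 * 0) * Real.cos φ) * (-lam / 2) *
        (Real.cosh (2 * 0) - Real.sinh (2 * 0) * Real.cos φ) ^ (-lam / 2 - 1)) :=
    strictAntiOn_sinh_mul_deriv h0 h2 self_mem_Ici (mem_Ici.mpr ht.le) ht
  rw [sinh_mul_deriv_zero] at hw
  have hs : 0 < Real.sinh (2 * t) := Real.sinh_pos_iff.mpr (by linarith)
  rw [deriv_sph_hyp]
  exact neg_of_mul_neg_right hw hs.le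

/-- **`∂_t sph λ (a_t) > 0` for `t > 0` and `λ < 0` or `λ > 2`.** -/
theorem deriv_sph_hyp_pos {lam : ℝ} (h : lam < 0 ∨ 2 < lam) {t : ℝ} (ht : 0 < t) :
    0 < deriv (fun t => sph lam (hyp t)) t := by
  have hw : Real.sinh (2 * 0) * ((2 * π)⁻¹ * ∫ φ in (-π)..π,
      (2 * Real.sinh (2 * 0) - 2 * Real.cosh (2 * 0) * Real.cos φ) * (-lam / 2) *
        (Real.cosh (2 * 0) - Real.sinh (2 * 0) * Real.cos φ) ^ (-lam / 2 - 1)) <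
      Real.sinh (2 * t) * ((2 * π)⁻¹ * ∫ φ in (-π)..π,
      (2 * Real.sinh (2 * t) - 2 * Real.cosh (2 * t) * Real.cos φ) * (-lam / 2) *
        (Real.cosh (2 * t) - Real.sinh (2 * t) * Real.cos φ) ^ (-lam / 2 - 1)) :=
    strictMonoOn_sinh_mul_deriv h self_mem_Ici (mem_Ici.mpr ht.le) ht
  rw [sinh_mul_deriv_zero] at hw
  have hs : 0 < Real.sinh (2 * t) := Real.sinh_pos_iff.mpr (by linarith)
  rw [deriv_sph_hyp]
  exact pos_of_mul_pos_right hw hs.le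

/-- **`t ↦ sph λ (a_t)` is strictly decreasing on `[0, ∞)` for `0 < λ < 2`.** -/
theorem strictAntiOn_sph_hyp {lam : ℝ} (h0 : 0 < lam) (h2 : lam < 2) :
    StrictAntiOn (fun t => sph lam (hyp t)) (Ici 0) :=
  strictAntiOn_of_deriv_neg (convex_Ici 0) (continuous_sph_hyp lam).continuousOn fun t ht =>
    deriv_sph_hyp_neg h0 h2 (by rwa [interior_Ici] at ht)

/-- **`t ↦ sph λ (a_t)` is strictly increasing on `[0, ∞)` for `λ < 0` or `λ > 2`.** -/
theorem strictMonoOn_sph_hyp {lam : ℝ} (h : lam < 0 ∨ 2 < lam) :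
    StrictMonoOn (fun t => sph lam (hyp t)) (Ici 0) :=
  strictMonoOn_of_deriv_pos (convex_Ici 0) (continuous_sph_hyp lam).continuousOn fun t ht =>
    deriv_sph_hyp_pos h (by rwa [interior_Ici] at ht)

/-- **Harish-Chandra's `Ξ(a_t)` is strictly decreasing on `[0, ∞)`.** -/
theorem strictAntiOn_sph_one_hyp : StrictAntiOn (fun t => sph 1 (hyp t)) (Ici 0) :=
  strictAntiOn_sph_hyp zero_lt_one one_lt_two

/-- **On the group, `0 < λ < 2`: `sph λ g < sph λ h ⟺ cartanT h < cartanT g`.** -/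
theorem sph_lt_sph_iff_cartanT {lam : ℝ} (h0 : 0 < lam) (h2 : lam < 2) (g h : SU11) :
    sph lam g < sph lam h ↔ cartanT h < cartanT g := by
  rw [sph_eq_sph_hyp_cartanT lam g, sph_eq_sph_hyp_cartanT lam h]
  exact (strictAntiOn_sph_hyp h0 h2).lt_iff_gt (mem_Ici.mpr (cartanT_nonneg g))
    (mem_Ici.mpr (cartanT_nonneg h))

/-- **On the group, `λ < 0` or `λ > 2`: `sph λ g < sph λ h ⟺ cartanT g < cartanT h`.** -/
theorem sph_lt_sph_iff_cartanT' {lam : ℝ} (h : lam < 0 ∨ 2 < lam) (g h' : SU11) :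
    sph lam g < sph lam h' ↔ cartanT g < cartanT h' := by
  rw [sph_eq_sph_hyp_cartanT lam g, sph_eq_sph_hyp_cartanT lam h']
  exact (strictMonoOn_sph_hyp h).lt_iff_lt (mem_Ici.mpr (cartanT_nonneg g))
    (mem_Ici.mpr (cartanT_nonneg h'))

/-- **`0 < λ < 2`: `sph λ g < sph λ h ⟺ |a(h)| < |a(g)|`**, `|a(g)| = |(g)_{00}|`. -/
theorem sph_lt_sph_iff_norm_mat {lam : ℝ} (h0 : 0 < lam) (h2 : lam < 2) (g h : SU11) :
    sph lam g < sph lam h ↔ ‖mat h 0 0‖ < ‖mat g 0 0‖ := by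
  rw [sph_lt_sph_iff_cartanT h0 h2, cartanT_lt_iff_norm_mat]

/-- **`0 < λ < 2`: `sph λ g ≤ sph λ h ⟺ |a(h)| ≤ |a(g)|`.** -/
theorem sph_le_sph_iff_norm_mat {lam : ℝ} (h0 : 0 < lam) (h2 : lam < 2) (g h : SU11) :
    sph lam g ≤ sph lam h ↔ ‖mat h 0 0‖ ≤ ‖mat g 0 0‖ := by
  rw [← not_lt, ← not_lt, sph_lt_sph_iff_norm_mat h0 h2]

end measure

end Summit.Ventures.HodgeRepro2.T5SU11SphericalMonotone
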